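import Summits.QuantumFields.YangMills.Theorems.FluctuationComparisonRegPrIntLLargeFieldGasBareOfTwoGas
import Summits.QuantumFields.YangMills.Theorems.FluctuationComparisonRegPrIntLLargeFieldGasIdentityOfWeakForm
import HarnessLib

/-!
# THE LF ENGINE TARGET AFTER TONIGHT (G21, px10 lineage, FILE N): the registered `LargeFieldFourPtIntCan` from the BARE TWO-GAS WEAK PACKAGE — rows (cat) (vloc) (vm) (vKP)
# (hloc) (hm) (hbd) (num) + the fine-lattice weak form of (ID); NO continuity, NO chart, NO Radon–Nikodym tower on the engine's side

Cell `ym3-torus` (HUMAN RULING D-0037: rung R3 = continuum `SU(2)` Yang–Mills on `T³` — NOT `d = 4`, NOT infinite volume, NOT a mass gap, NOT the Clay problem); width seat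
`ym3-torus-px10` (gen 19); helper of the crux `stmt-QuantumFields-20520` `UnitScaleTilt.FluctuationComparisonRegPrIntL` (`--supports … --as helper`, NOT a proof of it).
THEOREMS ONLY: 0 `def`, 0 `instance`, 0 `notation`, 0 `sorry`, default heartbeats.

WHAT.  ✓FILE I made `stub_largeFieldFourPtIntCan` rest on the TWO-GAS WEAK PACKAGE `h2W` (the (ID) row in fine-lattice weak form, continuity rows (vc)∕(hc) kept); ✓FILES J∕K∕L∕M
struck continuity from the whole chain below the two-gas package.  In weak currency the a.e. row is recovered by ✓FILE H `heightDensity_mul_ae_eq_of_fineWeakForm`, which needs the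
two gases MEASURABLE — so the weak bare package trades (vc)∕(hc) for (vm) `∀ X, Measurable (v · X)` ∕ (hm) `∀ Q′ X, Measurable (h₂ Q′ X ·)`:
* §1 `measurable_polymerPartitionFunction`, `measurable_holeSum` (finite sums∕products of measurable activities);
* §2 ★★`identityRowBare_of_fineWeakForm` — (vm)+(hm)+weak form ⟹ ✓FILE E's (ID) row VERBATIM;
* §3 ★★★`twoGasBareBody_of_fineWeakForm` — the `(J,K)`-body of ✓FILE M's bare two-gas package (with (vm)∕(hm) in the slots of (vc)∕(hc));
* §4 ★★★`largeFieldFourPtIntCan_of_twoGasWeakBarePackage : ⟨h2Wb⟩ → ⟨LargeFieldFourPtIntCan :588 VERBATIM⟩`, `h2Wb` = ✓FILE E's `h2P` text with exactly three rows changed: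
  (vc) ↦ (vm), (hc) ↦ (hm), (ID) ↦ the weak-form row of ✓FILE I — via ✓FILE M `largeFieldFourPtIntCan_of_twoGasBarePackage` (whose (vm)∕(hm) slots are filled by name; the
  bare package quantifies nothing about them beyond what §3 passes through).
NET BY NAME: the 𝐑-operation hand proves, per `(J,K)` on run `K`'s FINE lattice, identities of integrals `∫_{E_Q} e^{−β_K A}·(1_T·Ξ_v(Λ))(D V) dV_K = ∫_{E_∅} e^{−β_K A}·(1_T·Σ_S Πh₂·Ξ_v)(D V) dV_K`
with measurable V-local activities obeying the Kotecký–Preiss ∕ hole rows — and nothing else at this stub.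

HONEST — WHAT THIS IS NOT.  Re-threading; nothing of Bałaban's analysis; `h2Wb` IS the d = 3 large-field 𝐑-operation in identity form (XL, OPEN, unprinted in d = 3 and d = 4 alike —
UV3-NODE §45∕45.6); `h2P`∕`h2W`∕`h2Wb`, LF-INT∘, `stub_largeFieldFourPtIntCan`, S2β, the crux 20520 NOT proved; `YM3TorusSU2` NOT proved; finite volume ∕ conditional; the
Yang–Mills mass gap (Clay) NOT proved; rung R3 = YM₃ on `T³` — NOT `d = 4`, NOT infinite volume, NOT a mass gap.
References: [Balaban1985UV3] CMP 102 (1985) (2), (6)–(7), Thm 1 p.257, Thm 2 p.272, (41), (43)–(47) pp.266–267, (67)–(71); [Balaban1989LargeFieldII] CMP 122 (1989) (1.72), (1.90)–(1.91),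
(1.97)–(1.101); [KoteckyPreiss1986] CMP 103 (1986) Theorem p.492 (1).
-/

set_option autoImplicit false

noncomputable section

open Finset MeasureTheory Filter Topology Set
open scoped BigOperators
open Literature.Probability.LatticeModels
open Literature.MathematicalPhysics.QuantumFieldTheory.Balaban1983to89
open Literature.MathematicalPhysics.QuantumFieldTheory.Balaban1983to89.T3ContinuumYM3Torus
open Literature.MathematicalPhysics.QuantumFieldTheory.Balaban1983to89.T3NestedUnitLaws
open Literature.MathematicalPhysics.QuantumFieldTheory.Balaban1983to89.T3UnitLawDensityEML
open Literature.MathematicalPhysics.QuantumFieldTheory.Balaban1983to89.T3UnitScaleTilt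
open Literature.MathematicalPhysics.QuantumFieldTheory.Balaban1983to89.T3TiltDescent
open Literature.MathematicalPhysics.QuantumFieldTheory.Balaban1983to89.T3PrintedRegularMinimiser
open Literature.MathematicalPhysics.QuantumFieldTheory.Balaban1983to89.T3LevelShift
open Literature.MathematicalPhysics.QuantumFieldTheory.Balaban1983to89.Missing
open Literature.MathematicalPhysics.QuantumFieldTheory.Balaban1983to89.T4Continuum
open scoped Literature.MathematicalPhysics.QuantumFieldTheory.Balaban1983to89.T3OrbitAverage
open Literature.MathematicalPhysics.QuantumFieldTheory.Balaban1983to89.Node00 (touchingGraph SiteTouch)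
open Literature.MathematicalPhysics.QuantumFieldTheory.Balaban1983to89.B5Eq118OneStroke (iterBlockOf)
open Literature.MathematicalPhysics.QuantumFieldTheory.BalabanImbrieJaffe1984to88.BIJ85BlockAveragesTorusK (blkIter)
open Literature.MathematicalPhysics.QuantumFieldTheory.Balaban1983to89.B16RatioResummation (IsHoleFamily vacCompat)
open Summit.QuantumFields.YangMills.Theorems.FluctuationComparisonRegPrIntLWregGlue (heightDensityCan)
open Summit.QuantumFields.YangMills.Theorems.FluctuationComparisonRegPrIntLHistoryPartition (LFLabel histEvent smallFactor measurableSet_histEvent)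
open Summit.QuantumFields.YangMills.Theorems.FluctuationComparisonRegPrIntLLargeFieldGasIdentityOfWeakForm (heightDensity_mul_ae_eq_of_fineWeakForm)
open Summit.QuantumFields.YangMills.Theorems.FluctuationComparisonRegPrIntLLargeFieldGasBareOfTwoGas (largeFieldFourPtIntCan_of_twoGasBarePackage)

namespace Summit.QuantumFields.YangMills.Theorems.FluctuationComparisonRegPrIntLLargeFieldGasBareOfWeakForm

/-! ## §1 Measurable activities give measurable finite gases -/

/-- ★ **MEASURABLE ACTIVITIES GIVE A MEASURABLE FINITE GAS** on any catalogue (complex-valued partition function; finite sums of finite products). [cite: Balaban1989LargeFieldII, (1.90) p.388 (bookkeeping)] -/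
theorem measurable_polymerPartitionFunction {Pol : Type*} [DecidableEq Pol] (inc : Pol → Pol → Prop) [DecidableRel inc]
    {Y : Type*} [MeasurableSpace Y] (w : Y → Pol → ℝ) (Λ : Finset Pol) (hw : ∀ X ∈ Λ, Measurable (fun U => w U X)) :
    Measurable (fun U => polymerPartitionFunction inc (fun X => ((w U X : ℝ) : ℂ)) Λ) := by
  unfold polymerPartitionFunction
  refine Finset.measurable_sum _ fun A hA => ?_
  by_cases hc : IsCompatible inc A
  · simp only [if_pos hc]
    exact Finset.measurable_prod _ fun X hX => Complex.measurable_ofReal.comp (hw X (Finset.mem_powerset.mp hA hX))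
  · simp only [if_neg hc]
    exact measurable_const

/-- The HOLE SUM is measurable when every hole activity and every vacuum activity is. [cite: Balaban1989LargeFieldII, (1.72) p.379 (bookkeeping)] -/
theorem measurable_holeSum {Pol : Type*} [DecidableEq Pol] (inc : Pol → Pol → Prop) [DecidableRel inc]
    {Y : Type*} [MeasurableSpace Y] (𝒮 : Finset (Finset Pol)) (h : Pol → Y → ℝ) (v : Y → Pol → ℝ) (Λ : Finset Pol → Finset Pol)
    (hh : ∀ X, Measurable (fun U => h X U)) (hv : ∀ X, Measurable (fun U => v U X)) :
    Measurable (fun U => ∑ S ∈ 𝒮, (∏ X ∈ S, ((h X U : ℝ) : ℂ)) * polymerPartitionFunction inc (fun X => ((v U X : ℝ) : ℂ)) (Λ S)) :=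
  Finset.measurable_sum _ fun S _ =>
    (Finset.measurable_prod _ fun X _ => Complex.measurable_ofReal.comp (hh X)).mul (measurable_polymerPartitionFunction inc v (Λ S) fun X _ => hv X)

/-! ## §2 The (ID) row from the fine-lattice weak form, measurable activities -/

section Row

variable (F : T3Family) {γ : ℝ} (c b₀ p₀ : ℝ) {J K : ℕ} (hJK : J ≤ K) (μ' : ℕ)
  (Λ : Finset (Finset (PBond (F.P J) 0))) (v : GaugeField (F.P J) 0 (Matrix.specialUnitaryGroup (Fin 2) ℂ) → Finset (PBond (F.P J) 0) → ℝ)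
  (h₂ : Finset (LFLabel F K J) → Finset (PBond (F.P J) 0) → GaugeField (F.P J) 0 (Matrix.specialUnitaryGroup (Fin 2) ℂ) → ℝ)

open Classical in
/-- ★★ **THE (ID) ROW FROM THE FINE-LATTICE WEAK FORM, MEASURABLE ACTIVITIES** (✓FILE I `identityRow_of_fineWeakForm` with (vc)∕(hc) traded for measurability (vm)∕(hm);
conclusion = ✓FILE E's (ID) row VERBATIM): ✓FILE H `heightDensity_mul_ae_eq_of_fineWeakForm` at the package's letters. [cite: Balaban1985UV3, (2) p.256, (7) p.257, Thm 2 p.272, (41), (43)-(47) pp.266-267; Balaban1989LargeFieldII, (1.72) p.379 and (1.90) p.388] -/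
theorem identityRowBare_of_fineWeakForm (hγ : 0 ≤ γ)
    (hvm : ∀ X : Finset (PBond (F.P J) 0), Measurable (fun U : GaugeField (F.P J) 0 (Matrix.specialUnitaryGroup (Fin 2) ℂ) => v U X))
    (hhm : ∀ (Q' : Finset (LFLabel F K J)) (X : Finset (PBond (F.P J) 0)), Measurable (fun U : GaugeField (F.P J) 0 (Matrix.specialUnitaryGroup (Fin 2) ℂ) => h₂ Q' X U))
    (hweak : ∀ Q : Finset (LFLabel F K J), (∀ l ∈ Q, l.1.val < K - J) →
      ∀ T ⊆ {U : GaugeField (F.P J) 0 (Matrix.specialUnitaryGroup (Fin 2) ℂ) | PlaqSmall (θBal F.L γ (c * b₀) p₀ J) U}, MeasurableSet T →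
        (∃ C : ℝ, ∀ U ∈ T, ‖polymerPartitionFunction polyInc (fun X => ((v U X : ℝ) : ℂ)) Λ‖ ≤ C ∧
          ‖∑ S ∈ (Finset.univ : Finset (Finset (PBond (F.P J) 0))).powerset.filter
                        (IsHoleFamily (fun X => (∃ l ∈ Q, (⟨siteShift (F.sitesPerDir_eq (m := F.m) (K := K) (j := l.1.val + (K - J - l.1.val)) (m' := F.m) (K' := J) (j' := 0)
              (by have := l.1.isLt; omega)) (blkIter (K - J - l.1.val) l.2.src), l.2.μ⟩ : PBond (F.P J) 0) ∈ X) ∧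
                          ∃ Fc : Finset (Site (F.P J) μ'), ((touchingGraph (SiteTouch (P := F.P J) (j := μ'))).induce (Fc : Set (Site (F.P J) μ'))).Connected ∧
                            Fc.biUnion (fun y => Finset.univ.filter (fun b : PBond (F.P J) 0 => iterBlockOf μ' b.src = y)) = X)
                          (Q.image fun l => (⟨siteShift (F.sitesPerDir_eq (m := F.m) (K := K) (j := l.1.val + (K - J - l.1.val)) (m' := F.m) (K' := J) (j' := 0)
              (by have := l.1.isLt; omega)) (blkIter (K - J - l.1.val) l.2.src), l.2.μ⟩ : PBond (F.P J) 0))),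
                      (∏ X ∈ S, ((h₂ (Q.filter fun l => (⟨siteShift (F.sitesPerDir_eq (m := F.m) (K := K) (j := l.1.val + (K - J - l.1.val)) (m' := F.m) (K' := J) (j' := 0)
              (by have := l.1.isLt; omega)) (blkIter (K - J - l.1.val) l.2.src), l.2.μ⟩ : PBond (F.P J) 0) ∈ X) X U : ℝ) : ℂ)) *
                        polymerPartitionFunction polyInc (fun X => ((v U X : ℝ) : ℂ)) (vacCompat Λ S)‖ ≤ C) →
        ∫ U' : GaugeField (F.P K) 0 (Matrix.specialUnitaryGroup (Fin 2) ℂ),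
            (((histEvent F (θBal F.L γ b₀ p₀) K J Q).indicator (boltzmann (F.P K) ((F.scheme ℰp γ).β K)) U' : ℝ) : ℂ) *
              T.indicator (fun U => polymerPartitionFunction polyInc (fun X => ((v U X : ℝ) : ℂ)) Λ) (descendTo F ℰp J K hJK U')
          ∂fieldMeasure (F.P K) 0 (Matrix.specialUnitaryGroup (Fin 2) ℂ) =
        ∫ U' : GaugeField (F.P K) 0 (Matrix.specialUnitaryGroup (Fin 2) ℂ),
            (((histGood F ℰp (θBal F.L γ b₀ p₀) K J).indicator (boltzmann (F.P K) ((F.scheme ℰp γ).β K)) U' : ℝ) : ℂ) *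
              T.indicator (fun U => ∑ S ∈ (Finset.univ : Finset (Finset (PBond (F.P J) 0))).powerset.filter
                        (IsHoleFamily (fun X => (∃ l ∈ Q, (⟨siteShift (F.sitesPerDir_eq (m := F.m) (K := K) (j := l.1.val + (K - J - l.1.val)) (m' := F.m) (K' := J) (j' := 0)
              (by have := l.1.isLt; omega)) (blkIter (K - J - l.1.val) l.2.src), l.2.μ⟩ : PBond (F.P J) 0) ∈ X) ∧
                          ∃ Fc : Finset (Site (F.P J) μ'), ((touchingGraph (SiteTouch (P := F.P J) (j := μ'))).induce (Fc : Set (Site (F.P J) μ'))).Connected ∧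
                            Fc.biUnion (fun y => Finset.univ.filter (fun b : PBond (F.P J) 0 => iterBlockOf μ' b.src = y)) = X)
                          (Q.image fun l => (⟨siteShift (F.sitesPerDir_eq (m := F.m) (K := K) (j := l.1.val + (K - J - l.1.val)) (m' := F.m) (K' := J) (j' := 0)
              (by have := l.1.isLt; omega)) (blkIter (K - J - l.1.val) l.2.src), l.2.μ⟩ : PBond (F.P J) 0))),
                      (∏ X ∈ S, ((h₂ (Q.filter fun l => (⟨siteShift (F.sitesPerDir_eq (m := F.m) (K := K) (j := l.1.val + (K - J - l.1.val)) (m' := F.m) (K' := J) (j' := 0)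
              (by have := l.1.isLt; omega)) (blkIter (K - J - l.1.val) l.2.src), l.2.μ⟩ : PBond (F.P J) 0) ∈ X) X U : ℝ) : ℂ)) *
                        polymerPartitionFunction polyInc (fun X => ((v U X : ℝ) : ℂ)) (vacCompat Λ S)) (descendTo F ℰp J K hJK U')
          ∂fieldMeasure (F.P K) 0 (Matrix.specialUnitaryGroup (Fin 2) ℂ)) :
    ∀ Q : Finset (LFLabel F K J), (∀ l ∈ Q, l.1.val < K - J) →
              ∀ᵐ U ∂fieldMeasure (F.P J) 0 (Matrix.specialUnitaryGroup (Fin 2) ℂ), U ∈ {U : GaugeField (F.P J) 0 (Matrix.specialUnitaryGroup (Fin 2) ℂ) | PlaqSmall (θBal F.L γ (c * b₀) p₀ J) U} →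
                (heightDensity F γ hJK (histEvent F (θBal F.L γ b₀ p₀) K J Q) U : ℂ) *
                    polymerPartitionFunction polyInc (fun X => ((v U X : ℝ) : ℂ)) Λ =
                  (heightDensity F γ hJK (histGood F ℰp (θBal F.L γ b₀ p₀) K J) U : ℂ) *
                    ∑ S ∈ (Finset.univ : Finset (Finset (PBond (F.P J) 0))).powerset.filter
                        (IsHoleFamily (fun X => (∃ l ∈ Q, (⟨siteShift (F.sitesPerDir_eq (m := F.m) (K := K) (j := l.1.val + (K - J - l.1.val)) (m' := F.m) (K' := J) (j' := 0)
              (by have := l.1.isLt; omega)) (blkIter (K - J - l.1.val) l.2.src), l.2.μ⟩ : PBond (F.P J) 0) ∈ X) ∧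
                          ∃ Fc : Finset (Site (F.P J) μ'), ((touchingGraph (SiteTouch (P := F.P J) (j := μ'))).induce (Fc : Set (Site (F.P J) μ'))).Connected ∧
                            Fc.biUnion (fun y => Finset.univ.filter (fun b : PBond (F.P J) 0 => iterBlockOf μ' b.src = y)) = X)
                          (Q.image fun l => (⟨siteShift (F.sitesPerDir_eq (m := F.m) (K := K) (j := l.1.val + (K - J - l.1.val)) (m' := F.m) (K' := J) (j' := 0)
              (by have := l.1.isLt; omega)) (blkIter (K - J - l.1.val) l.2.src), l.2.μ⟩ : PBond (F.P J) 0))),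
                      (∏ X ∈ S, ((h₂ (Q.filter fun l => (⟨siteShift (F.sitesPerDir_eq (m := F.m) (K := K) (j := l.1.val + (K - J - l.1.val)) (m' := F.m) (K' := J) (j' := 0)
              (by have := l.1.isLt; omega)) (blkIter (K - J - l.1.val) l.2.src), l.2.μ⟩ : PBond (F.P J) 0) ∈ X) X U : ℝ) : ℂ)) *
                        polymerPartitionFunction polyInc (fun X => ((v U X : ℝ) : ℂ)) (vacCompat Λ S) := by
  intro Q hQ
  have hW : MeasurableSet {U : GaugeField (F.P J) 0 (Matrix.specialUnitaryGroup (Fin 2) ℂ) | PlaqSmall (θBal F.L γ (c * b₀) p₀ J) U} := measurableSet_plaqSmall _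
  have hA : Measurable (fun U : GaugeField (F.P J) 0 (Matrix.specialUnitaryGroup (Fin 2) ℂ) => polymerPartitionFunction polyInc (fun X => ((v U X : ℝ) : ℂ)) Λ) :=
    measurable_polymerPartitionFunction polyInc v Λ fun X _ => hvm X
  have hB : Measurable (fun U : GaugeField (F.P J) 0 (Matrix.specialUnitaryGroup (Fin 2) ℂ) =>
      ∑ S ∈ (Finset.univ : Finset (Finset (PBond (F.P J) 0))).powerset.filter
                        (IsHoleFamily (fun X => (∃ l ∈ Q, (⟨siteShift (F.sitesPerDir_eq (m := F.m) (K := K) (j := l.1.val + (K - J - l.1.val)) (m' := F.m) (K' := J) (j' := 0)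
              (by have := l.1.isLt; omega)) (blkIter (K - J - l.1.val) l.2.src), l.2.μ⟩ : PBond (F.P J) 0) ∈ X) ∧
                          ∃ Fc : Finset (Site (F.P J) μ'), ((touchingGraph (SiteTouch (P := F.P J) (j := μ'))).induce (Fc : Set (Site (F.P J) μ'))).Connected ∧
                            Fc.biUnion (fun y => Finset.univ.filter (fun b : PBond (F.P J) 0 => iterBlockOf μ' b.src = y)) = X)
                          (Q.image fun l => (⟨siteShift (F.sitesPerDir_eq (m := F.m) (K := K) (j := l.1.val + (K - J - l.1.val)) (m' := F.m) (K' := J) (j' := 0)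
              (by have := l.1.isLt; omega)) (blkIter (K - J - l.1.val) l.2.src), l.2.μ⟩ : PBond (F.P J) 0))),
                      (∏ X ∈ S, ((h₂ (Q.filter fun l => (⟨siteShift (F.sitesPerDir_eq (m := F.m) (K := K) (j := l.1.val + (K - J - l.1.val)) (m' := F.m) (K' := J) (j' := 0)
              (by have := l.1.isLt; omega)) (blkIter (K - J - l.1.val) l.2.src), l.2.μ⟩ : PBond (F.P J) 0) ∈ X) X U : ℝ) : ℂ)) *
                        polymerPartitionFunction polyInc (fun X => ((v U X : ℝ) : ℂ)) (vacCompat Λ S)) :=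
    measurable_holeSum polyInc _ (fun X U => h₂ (Q.filter fun l => (⟨siteShift (F.sitesPerDir_eq (m := F.m) (K := K) (j := l.1.val + (K - J - l.1.val)) (m' := F.m) (K' := J) (j' := 0)
              (by have := l.1.isLt; omega)) (blkIter (K - J - l.1.val) l.2.src), l.2.μ⟩ : PBond (F.P J) 0) ∈ X) X U) v (fun S => vacCompat Λ S)
      (fun X => hhm _ X) hvm
  exact heightDensity_mul_ae_eq_of_fineWeakForm F hJK hγ (measurableSet_histEvent (θBal F.L γ b₀ p₀) K J Q)
    (measurableSet_histGood F ℰp measurableE_ℰp (θBal F.L γ b₀ p₀) K J) hW hA hB (hweak Q hQ)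

end Row

/-! ## §3 The `(J, K)`-body of the bare two-gas package from its rows and the weak form -/

section Body

variable (F : T3Family) {γ : ℝ} (c b₀ p₀ a₂ : ℝ) {J K : ℕ} (hJK : J ≤ K) (μ μ' : ℕ)
  (Λ : Finset (Finset (PBond (F.P J) 0))) (v : GaugeField (F.P J) 0 (Matrix.specialUnitaryGroup (Fin 2) ℂ) → Finset (PBond (F.P J) 0) → ℝ)
  (h₂ : Finset (LFLabel F K J) → Finset (PBond (F.P J) 0) → GaugeField (F.P J) 0 (Matrix.specialUnitaryGroup (Fin 2) ℂ) → ℝ) (τ κ' κh : ℝ)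

open Classical in
/-- ★★★ **THE `(J, K)`-BODY OF THE BARE TWO-GAS PACKAGE** (✓FILE M's hypothesis body: ✓FILE E ll.134–173 with (vc)∕(hc) DELETED) from its rows, the measurability rows (vm)∕(hm) and the weak form.
[cite: Balaban1985UV3, Thm 1 p.257, (7) p.257, Thm 2 p.272, (41), (43)-(47) pp.266-267 and (67)-(71) pp.273-274; Balaban1989LargeFieldII, (1.72) p.379, (1.90)-(1.91) p.388 and (1.97)-(1.101) pp.389-390; KoteckyPreiss1986, Theorem p.492 (1)] -/
theorem twoGasBareBody_of_fineWeakForm (hγ : 0 ≤ γ) (hμ'μ : μ' ≤ μ) (hμ'J : μ' ≤ F.m + J)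
    (hcat : ∀ X ∈ Λ, X.Nonempty ∧ ∃ Fc : Finset (Site (F.P J) μ'), ((touchingGraph (SiteTouch (P := F.P J) (j := μ'))).induce (Fc : Set (Site (F.P J) μ'))).Connected ∧
              Fc.biUnion (fun y => Finset.univ.filter (fun b : PBond (F.P J) 0 => iterBlockOf μ' b.src = y)) = X)
    (hvloc : ∀ (X : Finset (PBond (F.P J) 0)) (U U' : GaugeField (F.P J) 0 (Matrix.specialUnitaryGroup (Fin 2) ℂ)), (∀ e ∈ X, U e = U' e) → v U X = v U' X)
    (hvm : ∀ X : Finset (PBond (F.P J) 0), Measurable (fun U : GaugeField (F.P J) 0 (Matrix.specialUnitaryGroup (Fin 2) ℂ) => v U X))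
    (hKP : ∀ U ∈ {U : GaugeField (F.P J) 0 (Matrix.specialUnitaryGroup (Fin 2) ℂ) | PlaqSmall (θBal F.L γ (c * b₀) p₀ J) U},
              ∀ σ : Finset (PBond (F.P J) 0), ∑ γ' ∈ Finset.univ.filter (fun γ' : Finset (PBond (F.P J) 0) => polyInc γ' σ),
                |v U γ'| * Real.exp (τ * (((γ'.image (fun b : PBond (F.P J) 0 => iterBlockOf μ' b.src)).card : ℕ) : ℝ) +
                  κ' * (((γ'.image (fun b : PBond (F.P J) 0 => iterBlockOf μ' b.src)).card : ℕ) : ℝ)) ≤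
                τ * (((σ.image (fun b : PBond (F.P J) 0 => iterBlockOf μ' b.src)).card : ℕ) : ℝ))
    (hhloc : ∀ (Q' : Finset (LFLabel F K J)) (X : Finset (PBond (F.P J) 0)) (U U' : GaugeField (F.P J) 0 (Matrix.specialUnitaryGroup (Fin 2) ℂ)),
              (∀ e ∈ X, U e = U' e) → h₂ Q' X U = h₂ Q' X U')
    (hhm : ∀ (Q' : Finset (LFLabel F K J)) (X : Finset (PBond (F.P J) 0)), Measurable (fun U : GaugeField (F.P J) 0 (Matrix.specialUnitaryGroup (Fin 2) ℂ) => h₂ Q' X U))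
    (hhbd : ∀ (Q' : Finset (LFLabel F K J)) (X : Finset (PBond (F.P J) 0)) (U : GaugeField (F.P J) 0 (Matrix.specialUnitaryGroup (Fin 2) ℂ)), U ∈ {U : GaugeField (F.P J) 0 (Matrix.specialUnitaryGroup (Fin 2) ℂ) | PlaqSmall (θBal F.L γ (c * b₀) p₀ J) U} →
              (∀ l ∈ Q', l.1.val < K - J) →
              |h₂ Q' X U| ≤ (∏ l ∈ Q', (if l.1.val < K - J then smallFactor F.L γ b₀ p₀ a₂ (K - l.1.val) else 0)) *
                Real.exp (-(κh * (((X.image (fun b : PBond (F.P J) 0 => iterBlockOf μ' b.src)).card : ℕ) : ℝ))))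
    (hnum : 4 + 2 * Real.log 26 ≤ κ' ∧ 0 < τ ∧ κ' + Real.exp (τ / κ') * τ + (2 + 2 * Real.log 26) ≤ κh)
    (hweak : ∀ Q : Finset (LFLabel F K J), (∀ l ∈ Q, l.1.val < K - J) →
      ∀ T ⊆ {U : GaugeField (F.P J) 0 (Matrix.specialUnitaryGroup (Fin 2) ℂ) | PlaqSmall (θBal F.L γ (c * b₀) p₀ J) U}, MeasurableSet T →
        (∃ C : ℝ, ∀ U ∈ T, ‖polymerPartitionFunction polyInc (fun X => ((v U X : ℝ) : ℂ)) Λ‖ ≤ C ∧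
          ‖∑ S ∈ (Finset.univ : Finset (Finset (PBond (F.P J) 0))).powerset.filter
                        (IsHoleFamily (fun X => (∃ l ∈ Q, (⟨siteShift (F.sitesPerDir_eq (m := F.m) (K := K) (j := l.1.val + (K - J - l.1.val)) (m' := F.m) (K' := J) (j' := 0)
              (by have := l.1.isLt; omega)) (blkIter (K - J - l.1.val) l.2.src), l.2.μ⟩ : PBond (F.P J) 0) ∈ X) ∧
                          ∃ Fc : Finset (Site (F.P J) μ'), ((touchingGraph (SiteTouch (P := F.P J) (j := μ'))).induce (Fc : Set (Site (F.P J) μ'))).Connected ∧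
                            Fc.biUnion (fun y => Finset.univ.filter (fun b : PBond (F.P J) 0 => iterBlockOf μ' b.src = y)) = X)
                          (Q.image fun l => (⟨siteShift (F.sitesPerDir_eq (m := F.m) (K := K) (j := l.1.val + (K - J - l.1.val)) (m' := F.m) (K' := J) (j' := 0)
              (by have := l.1.isLt; omega)) (blkIter (K - J - l.1.val) l.2.src), l.2.μ⟩ : PBond (F.P J) 0))),
                      (∏ X ∈ S, ((h₂ (Q.filter fun l => (⟨siteShift (F.sitesPerDir_eq (m := F.m) (K := K) (j := l.1.val + (K - J - l.1.val)) (m' := F.m) (K' := J) (j' := 0)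
              (by have := l.1.isLt; omega)) (blkIter (K - J - l.1.val) l.2.src), l.2.μ⟩ : PBond (F.P J) 0) ∈ X) X U : ℝ) : ℂ)) *
                        polymerPartitionFunction polyInc (fun X => ((v U X : ℝ) : ℂ)) (vacCompat Λ S)‖ ≤ C) →
        ∫ U' : GaugeField (F.P K) 0 (Matrix.specialUnitaryGroup (Fin 2) ℂ),
            (((histEvent F (θBal F.L γ b₀ p₀) K J Q).indicator (boltzmann (F.P K) ((F.scheme ℰp γ).β K)) U' : ℝ) : ℂ) *
              T.indicator (fun U => polymerPartitionFunction polyInc (fun X => ((v U X : ℝ) : ℂ)) Λ) (descendTo F ℰp J K hJK U')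
          ∂fieldMeasure (F.P K) 0 (Matrix.specialUnitaryGroup (Fin 2) ℂ) =
        ∫ U' : GaugeField (F.P K) 0 (Matrix.specialUnitaryGroup (Fin 2) ℂ),
            (((histGood F ℰp (θBal F.L γ b₀ p₀) K J).indicator (boltzmann (F.P K) ((F.scheme ℰp γ).β K)) U' : ℝ) : ℂ) *
              T.indicator (fun U => ∑ S ∈ (Finset.univ : Finset (Finset (PBond (F.P J) 0))).powerset.filter
                        (IsHoleFamily (fun X => (∃ l ∈ Q, (⟨siteShift (F.sitesPerDir_eq (m := F.m) (K := K) (j := l.1.val + (K - J - l.1.val)) (m' := F.m) (K' := J) (j' := 0)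
              (by have := l.1.isLt; omega)) (blkIter (K - J - l.1.val) l.2.src), l.2.μ⟩ : PBond (F.P J) 0) ∈ X) ∧
                          ∃ Fc : Finset (Site (F.P J) μ'), ((touchingGraph (SiteTouch (P := F.P J) (j := μ'))).induce (Fc : Set (Site (F.P J) μ'))).Connected ∧
                            Fc.biUnion (fun y => Finset.univ.filter (fun b : PBond (F.P J) 0 => iterBlockOf μ' b.src = y)) = X)
                          (Q.image fun l => (⟨siteShift (F.sitesPerDir_eq (m := F.m) (K := K) (j := l.1.val + (K - J - l.1.val)) (m' := F.m) (K' := J) (j' := 0)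
              (by have := l.1.isLt; omega)) (blkIter (K - J - l.1.val) l.2.src), l.2.μ⟩ : PBond (F.P J) 0))),
                      (∏ X ∈ S, ((h₂ (Q.filter fun l => (⟨siteShift (F.sitesPerDir_eq (m := F.m) (K := K) (j := l.1.val + (K - J - l.1.val)) (m' := F.m) (K' := J) (j' := 0)
              (by have := l.1.isLt; omega)) (blkIter (K - J - l.1.val) l.2.src), l.2.μ⟩ : PBond (F.P J) 0) ∈ X) X U : ℝ) : ℂ)) *
                        polymerPartitionFunction polyInc (fun X => ((v U X : ℝ) : ℂ)) (vacCompat Λ S)) (descendTo F ℰp J K hJK U')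
          ∂fieldMeasure (F.P K) 0 (Matrix.specialUnitaryGroup (Fin 2) ℂ)) :
          ∃ μ' : ℕ, μ' ≤ μ ∧ μ' ≤ F.m + J ∧
          ∃ (Λ : Finset (Finset (PBond (F.P J) 0))) (v : GaugeField (F.P J) 0 (Matrix.specialUnitaryGroup (Fin 2) ℂ) → Finset (PBond (F.P J) 0) → ℝ)
            (h₂ : Finset (LFLabel F K J) → Finset (PBond (F.P J) 0) → GaugeField (F.P J) 0 (Matrix.specialUnitaryGroup (Fin 2) ℂ) → ℝ) (τ κ' κh : ℝ),
            -- the vacuum catalogue: non-empty footprints of touching-connected families of `μ′`-blocks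
            (∀ X ∈ Λ, X.Nonempty ∧ ∃ Fc : Finset (Site (F.P J) μ'), ((touchingGraph (SiteTouch (P := F.P J) (j := μ'))).induce (Fc : Set (Site (F.P J) μ'))).Connected ∧
              Fc.biUnion (fun y => Finset.univ.filter (fun b : PBond (F.P J) 0 => iterBlockOf μ' b.src = y)) = X) ∧
            -- vacuum activities: V-local, Kotecký–Preiss (1) with size `τ·#blocks` and decay `κ′·#blocks` (NO continuity)
            (∀ (X : Finset (PBond (F.P J) 0)) (U U' : GaugeField (F.P J) 0 (Matrix.specialUnitaryGroup (Fin 2) ℂ)), (∀ e ∈ X, U e = U' e) → v U X = v U' X) ∧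
            (∀ U ∈ {U : GaugeField (F.P J) 0 (Matrix.specialUnitaryGroup (Fin 2) ℂ) | PlaqSmall (θBal F.L γ (c * b₀) p₀ J) U},
              ∀ σ : Finset (PBond (F.P J) 0), ∑ γ' ∈ Finset.univ.filter (fun γ' : Finset (PBond (F.P J) 0) => polyInc γ' σ),
                |v U γ'| * Real.exp (τ * (((γ'.image (fun b : PBond (F.P J) 0 => iterBlockOf μ' b.src)).card : ℕ) : ℝ) +
                  κ' * (((γ'.image (fun b : PBond (F.P J) 0 => iterBlockOf μ' b.src)).card : ℕ) : ℝ)) ≤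
                τ * (((σ.image (fun b : PBond (F.P J) 0 => iterBlockOf μ' b.src)).card : ℕ) : ℝ)) ∧
            -- hole activities: V-local, one small factor per deep hole and block decay (NO continuity)
            (∀ (Q' : Finset (LFLabel F K J)) (X : Finset (PBond (F.P J) 0)) (U U' : GaugeField (F.P J) 0 (Matrix.specialUnitaryGroup (Fin 2) ℂ)),
              (∀ e ∈ X, U e = U' e) → h₂ Q' X U = h₂ Q' X U') ∧
            (∀ (Q' : Finset (LFLabel F K J)) (X : Finset (PBond (F.P J) 0)) (U : GaugeField (F.P J) 0 (Matrix.specialUnitaryGroup (Fin 2) ℂ)), U ∈ {U : GaugeField (F.P J) 0 (Matrix.specialUnitaryGroup (Fin 2) ℂ) | PlaqSmall (θBal F.L γ (c * b₀) p₀ J) U} →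
              (∀ l ∈ Q', l.1.val < K - J) →
              |h₂ Q' X U| ≤ (∏ l ∈ Q', (if l.1.val < K - J then smallFactor F.L γ b₀ p₀ a₂ (K - l.1.val) else 0)) *
                Real.exp (-(κh * (((X.image (fun b : PBond (F.P J) 0 => iterBlockOf μ' b.src)).card : ℕ) : ℝ)))) ∧
            -- numeric rows: tree decay per block beats the entropy of block animals; the hole decay pays for the attached clusters
            4 + 2 * Real.log 26 ≤ κ' ∧ 0 < τ ∧ κ' + Real.exp (τ / κ') * τ + (2 + 2 * Real.log 26) ≤ κh ∧
            -- THE UNNORMALISED IDENTITY per deep history, a.e. on the window: `ρ(E_Q)·Ξ_v(Λ) = ρ(E_∅)·Σ_S (Π h₂)·Ξ_v(vacCompat Λ S)`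
            (∀ Q : Finset (LFLabel F K J), (∀ l ∈ Q, l.1.val < K - J) →
              ∀ᵐ U ∂fieldMeasure (F.P J) 0 (Matrix.specialUnitaryGroup (Fin 2) ℂ), U ∈ {U : GaugeField (F.P J) 0 (Matrix.specialUnitaryGroup (Fin 2) ℂ) | PlaqSmall (θBal F.L γ (c * b₀) p₀ J) U} →
                (heightDensity F γ hJK (histEvent F (θBal F.L γ b₀ p₀) K J Q) U : ℂ) *
                    polymerPartitionFunction polyInc (fun X => ((v U X : ℝ) : ℂ)) Λ =
                  (heightDensity F γ hJK (histGood F ℰp (θBal F.L γ b₀ p₀) K J) U : ℂ) *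
                    ∑ S ∈ (Finset.univ : Finset (Finset (PBond (F.P J) 0))).powerset.filter
                        (IsHoleFamily (fun X => (∃ l ∈ Q, (⟨siteShift (F.sitesPerDir_eq (m := F.m) (K := K) (j := l.1.val + (K - J - l.1.val)) (m' := F.m) (K' := J) (j' := 0)
              (by have := l.1.isLt; omega)) (blkIter (K - J - l.1.val) l.2.src), l.2.μ⟩ : PBond (F.P J) 0) ∈ X) ∧
                          ∃ Fc : Finset (Site (F.P J) μ'), ((touchingGraph (SiteTouch (P := F.P J) (j := μ'))).induce (Fc : Set (Site (F.P J) μ'))).Connected ∧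
                            Fc.biUnion (fun y => Finset.univ.filter (fun b : PBond (F.P J) 0 => iterBlockOf μ' b.src = y)) = X)
                          (Q.image fun l => (⟨siteShift (F.sitesPerDir_eq (m := F.m) (K := K) (j := l.1.val + (K - J - l.1.val)) (m' := F.m) (K' := J) (j' := 0)
              (by have := l.1.isLt; omega)) (blkIter (K - J - l.1.val) l.2.src), l.2.μ⟩ : PBond (F.P J) 0))),
                      (∏ X ∈ S, ((h₂ (Q.filter fun l => (⟨siteShift (F.sitesPerDir_eq (m := F.m) (K := K) (j := l.1.val + (K - J - l.1.val)) (m' := F.m) (K' := J) (j' := 0)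
              (by have := l.1.isLt; omega)) (blkIter (K - J - l.1.val) l.2.src), l.2.μ⟩ : PBond (F.P J) 0) ∈ X) X U : ℝ) : ℂ)) *
                        polymerPartitionFunction polyInc (fun X => ((v U X : ℝ) : ℂ)) (vacCompat Λ S)) :=
  ⟨μ', hμ'μ, hμ'J, Λ, v, h₂, τ, κ', κh, hcat, hvloc, hKP, hhloc, hhbd, hnum.1, hnum.2.1, hnum.2.2,
    identityRowBare_of_fineWeakForm F c b₀ p₀ hJK μ' Λ v h₂ hγ hvm hhm hweak⟩

end Body

/-! ## §4 The registered stub from the BARE TWO-GAS WEAK PACKAGE -/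

open Classical in
/-- ★★★ **THE REGISTERED `LargeFieldFourPtIntCan` (registry v11.4 :588, VERBATIM) FROM THE BARE TWO-GAS WEAK PACKAGE** `h2Wb` = ✓FILE E's `h2P` with (vc)∕(hc) replaced by
MEASURABILITY (vm)∕(hm) and (ID) replaced by the fine-lattice weak form: `largeFieldFourPtIntCan_of_twoGasBarePackage ∘ twoGasBareBody_of_fineWeakForm` — THE LF ENGINE TARGET
after tonight: rows (cat) (vloc) (vm) (vKP) (hloc) (hm) (hbd) (num) + [Balaban1985UV3] Thm 2 in identity form on the FINE lattice; no continuity, no chart, no Radon–Nikodym tower.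
[cite: Balaban1985UV3, Thm 1 p.257, Thm 2 p.272, (41), (43)-(47) pp.266-267; Balaban1989LargeFieldII, (1.72) p.379, (1.90)-(1.91) p.388 and (1.97)-(1.101) pp.389-390; KoteckyPreiss1986, Theorem p.492 (1)] -/
theorem largeFieldFourPtIntCan_of_twoGasWeakBarePackage
    (h2Wb : ∀ (L : ℕ), ∃ μ : ℕ, ∃ a₂ : ℝ, 0 < a₂ ∧ ∃ c₀ : ℝ, 0 < c₀ ∧ c₀ ≤ 1 ∧ ∀ (c : ℝ), 0 < c → c ≤ c₀ → ∃ pS : ℝ, ∀ (b₀ p₀ : ℝ), 0 < b₀ → pS ≤ p₀ → 0 < p₀ →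
      ∃ γE : ℝ, 0 < γE ∧ ∀ (F : T3Family) (γ : ℝ), F.L = L → 0 < γ → γ ≤ γE →
        ∀ (J K : ℕ) (hJK : J ≤ K),
          {U : GaugeField (F.P J) 0 (Matrix.specialUnitaryGroup (Fin 2) ℂ) | PlaqSmall (θBal F.L γ (c * b₀) p₀ J) U} ⊆
            Node00.regSet (fieldMeasure (F.P J) 0 (Matrix.specialUnitaryGroup (Fin 2) ℂ)) (heightDensity F γ hJK Set.univ) →
          (∀ U : GaugeField (F.P J) 0 (Matrix.specialUnitaryGroup (Fin 2) ℂ), PlaqSmall (θBal F.L γ (c * b₀) p₀ J) U →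
              0 < heightDensityCan F γ hJK Set.univ U) →
          (∀ U : GaugeField (F.P J) 0 (Matrix.specialUnitaryGroup (Fin 2) ℂ), PlaqSmall (θBal F.L γ (c * b₀) p₀ J) U →
              0 < heightDensityCan F γ hJK (histGood F ℰp (θBal F.L γ b₀ p₀) K J) U) →
          ∃ μ' : ℕ, μ' ≤ μ ∧ μ' ≤ F.m + J ∧
          ∃ (Λ : Finset (Finset (PBond (F.P J) 0))) (v : GaugeField (F.P J) 0 (Matrix.specialUnitaryGroup (Fin 2) ℂ) → Finset (PBond (F.P J) 0) → ℝ)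
            (h₂ : Finset (LFLabel F K J) → Finset (PBond (F.P J) 0) → GaugeField (F.P J) 0 (Matrix.specialUnitaryGroup (Fin 2) ℂ) → ℝ) (τ κ' κh : ℝ),
            -- the vacuum catalogue: non-empty footprints of touching-connected families of `μ′`-blocks
            (∀ X ∈ Λ, X.Nonempty ∧ ∃ Fc : Finset (Site (F.P J) μ'), ((touchingGraph (SiteTouch (P := F.P J) (j := μ'))).induce (Fc : Set (Site (F.P J) μ'))).Connected ∧
              Fc.biUnion (fun y => Finset.univ.filter (fun b : PBond (F.P J) 0 => iterBlockOf μ' b.src = y)) = X) ∧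
            -- vacuum activities: V-local, MEASURABLE, Kotecký–Preiss (1) with size `τ·#blocks` and decay `κ′·#blocks`
            (∀ (X : Finset (PBond (F.P J) 0)) (U U' : GaugeField (F.P J) 0 (Matrix.specialUnitaryGroup (Fin 2) ℂ)), (∀ e ∈ X, U e = U' e) → v U X = v U' X) ∧
            (∀ X : Finset (PBond (F.P J) 0), Measurable (fun U : GaugeField (F.P J) 0 (Matrix.specialUnitaryGroup (Fin 2) ℂ) => v U X)) ∧
            (∀ U ∈ {U : GaugeField (F.P J) 0 (Matrix.specialUnitaryGroup (Fin 2) ℂ) | PlaqSmall (θBal F.L γ (c * b₀) p₀ J) U},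
              ∀ σ : Finset (PBond (F.P J) 0), ∑ γ' ∈ Finset.univ.filter (fun γ' : Finset (PBond (F.P J) 0) => polyInc γ' σ),
                |v U γ'| * Real.exp (τ * (((γ'.image (fun b : PBond (F.P J) 0 => iterBlockOf μ' b.src)).card : ℕ) : ℝ) +
                  κ' * (((γ'.image (fun b : PBond (F.P J) 0 => iterBlockOf μ' b.src)).card : ℕ) : ℝ)) ≤
                τ * (((σ.image (fun b : PBond (F.P J) 0 => iterBlockOf μ' b.src)).card : ℕ) : ℝ)) ∧
            -- hole activities: V-local, MEASURABLE, one small factor per deep hole and block decay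
            (∀ (Q' : Finset (LFLabel F K J)) (X : Finset (PBond (F.P J) 0)) (U U' : GaugeField (F.P J) 0 (Matrix.specialUnitaryGroup (Fin 2) ℂ)),
              (∀ e ∈ X, U e = U' e) → h₂ Q' X U = h₂ Q' X U') ∧
            (∀ (Q' : Finset (LFLabel F K J)) (X : Finset (PBond (F.P J) 0)), Measurable (fun U : GaugeField (F.P J) 0 (Matrix.specialUnitaryGroup (Fin 2) ℂ) => h₂ Q' X U)) ∧
            (∀ (Q' : Finset (LFLabel F K J)) (X : Finset (PBond (F.P J) 0)) (U : GaugeField (F.P J) 0 (Matrix.specialUnitaryGroup (Fin 2) ℂ)), U ∈ {U : GaugeField (F.P J) 0 (Matrix.specialUnitaryGroup (Fin 2) ℂ) | PlaqSmall (θBal F.L γ (c * b₀) p₀ J) U} →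
              (∀ l ∈ Q', l.1.val < K - J) →
              |h₂ Q' X U| ≤ (∏ l ∈ Q', (if l.1.val < K - J then smallFactor F.L γ b₀ p₀ a₂ (K - l.1.val) else 0)) *
                Real.exp (-(κh * (((X.image (fun b : PBond (F.P J) 0 => iterBlockOf μ' b.src)).card : ℕ) : ℝ)))) ∧
            -- numeric rows: tree decay per block beats the entropy of block animals; the hole decay pays for the attached clusters
            4 + 2 * Real.log 26 ≤ κ' ∧ 0 < τ ∧ κ' + Real.exp (τ / κ') * τ + (2 + 2 * Real.log 26) ≤ κh ∧
            -- THE FINE-LATTICE WEAK FORM of (ID) per deep history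
            (∀ Q : Finset (LFLabel F K J), (∀ l ∈ Q, l.1.val < K - J) →
      ∀ T ⊆ {U : GaugeField (F.P J) 0 (Matrix.specialUnitaryGroup (Fin 2) ℂ) | PlaqSmall (θBal F.L γ (c * b₀) p₀ J) U}, MeasurableSet T →
        (∃ C : ℝ, ∀ U ∈ T, ‖polymerPartitionFunction polyInc (fun X => ((v U X : ℝ) : ℂ)) Λ‖ ≤ C ∧
          ‖∑ S ∈ (Finset.univ : Finset (Finset (PBond (F.P J) 0))).powerset.filter
                        (IsHoleFamily (fun X => (∃ l ∈ Q, (⟨siteShift (F.sitesPerDir_eq (m := F.m) (K := K) (j := l.1.val + (K - J - l.1.val)) (m' := F.m) (K' := J) (j' := 0)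
              (by have := l.1.isLt; omega)) (blkIter (K - J - l.1.val) l.2.src), l.2.μ⟩ : PBond (F.P J) 0) ∈ X) ∧
                          ∃ Fc : Finset (Site (F.P J) μ'), ((touchingGraph (SiteTouch (P := F.P J) (j := μ'))).induce (Fc : Set (Site (F.P J) μ'))).Connected ∧
                            Fc.biUnion (fun y => Finset.univ.filter (fun b : PBond (F.P J) 0 => iterBlockOf μ' b.src = y)) = X)
                          (Q.image fun l => (⟨siteShift (F.sitesPerDir_eq (m := F.m) (K := K) (j := l.1.val + (K - J - l.1.val)) (m' := F.m) (K' := J) (j' := 0)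
              (by have := l.1.isLt; omega)) (blkIter (K - J - l.1.val) l.2.src), l.2.μ⟩ : PBond (F.P J) 0))),
                      (∏ X ∈ S, ((h₂ (Q.filter fun l => (⟨siteShift (F.sitesPerDir_eq (m := F.m) (K := K) (j := l.1.val + (K - J - l.1.val)) (m' := F.m) (K' := J) (j' := 0)
              (by have := l.1.isLt; omega)) (blkIter (K - J - l.1.val) l.2.src), l.2.μ⟩ : PBond (F.P J) 0) ∈ X) X U : ℝ) : ℂ)) *
                        polymerPartitionFunction polyInc (fun X => ((v U X : ℝ) : ℂ)) (vacCompat Λ S)‖ ≤ C) →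
        ∫ U' : GaugeField (F.P K) 0 (Matrix.specialUnitaryGroup (Fin 2) ℂ),
            (((histEvent F (θBal F.L γ b₀ p₀) K J Q).indicator (boltzmann (F.P K) ((F.scheme ℰp γ).β K)) U' : ℝ) : ℂ) *
              T.indicator (fun U => polymerPartitionFunction polyInc (fun X => ((v U X : ℝ) : ℂ)) Λ) (descendTo F ℰp J K hJK U')
          ∂fieldMeasure (F.P K) 0 (Matrix.specialUnitaryGroup (Fin 2) ℂ) =
        ∫ U' : GaugeField (F.P K) 0 (Matrix.specialUnitaryGroup (Fin 2) ℂ),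
            (((histGood F ℰp (θBal F.L γ b₀ p₀) K J).indicator (boltzmann (F.P K) ((F.scheme ℰp γ).β K)) U' : ℝ) : ℂ) *
              T.indicator (fun U => ∑ S ∈ (Finset.univ : Finset (Finset (PBond (F.P J) 0))).powerset.filter
                        (IsHoleFamily (fun X => (∃ l ∈ Q, (⟨siteShift (F.sitesPerDir_eq (m := F.m) (K := K) (j := l.1.val + (K - J - l.1.val)) (m' := F.m) (K' := J) (j' := 0)
              (by have := l.1.isLt; omega)) (blkIter (K - J - l.1.val) l.2.src), l.2.μ⟩ : PBond (F.P J) 0) ∈ X) ∧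
                          ∃ Fc : Finset (Site (F.P J) μ'), ((touchingGraph (SiteTouch (P := F.P J) (j := μ'))).induce (Fc : Set (Site (F.P J) μ'))).Connected ∧
                            Fc.biUnion (fun y => Finset.univ.filter (fun b : PBond (F.P J) 0 => iterBlockOf μ' b.src = y)) = X)
                          (Q.image fun l => (⟨siteShift (F.sitesPerDir_eq (m := F.m) (K := K) (j := l.1.val + (K - J - l.1.val)) (m' := F.m) (K' := J) (j' := 0)
              (by have := l.1.isLt; omega)) (blkIter (K - J - l.1.val) l.2.src), l.2.μ⟩ : PBond (F.P J) 0))),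
                      (∏ X ∈ S, ((h₂ (Q.filter fun l => (⟨siteShift (F.sitesPerDir_eq (m := F.m) (K := K) (j := l.1.val + (K - J - l.1.val)) (m' := F.m) (K' := J) (j' := 0)
              (by have := l.1.isLt; omega)) (blkIter (K - J - l.1.val) l.2.src), l.2.μ⟩ : PBond (F.P J) 0) ∈ X) X U : ℝ) : ℂ)) *
                        polymerPartitionFunction polyInc (fun X => ((v U X : ℝ) : ℂ)) (vacCompat Λ S)) (descendTo F ℰp J K hJK U')
          ∂fieldMeasure (F.P K) 0 (Matrix.specialUnitaryGroup (Fin 2) ℂ))) :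
    ∀ (L : ℕ), ∃ c₀ : ℝ, 0 < c₀ ∧ c₀ ≤ 1 ∧ ∀ (c : ℝ), 0 < c → c ≤ c₀ → ∃ pS : ℝ, ∀ (b₀ p₀ : ℝ), 0 < b₀ → pS ≤ p₀ → 0 < p₀ →
      ∃ γ₁ : ℝ, 0 < γ₁ ∧ ∃ κ : ℝ, 0 < κ ∧ ∀ (F : T3Family) (γ : ℝ), F.L = L → 0 < γ → γ ≤ γ₁ →
        ∃ ψ : ℕ → ℝ, (∀ J, 0 ≤ ψ J) ∧ Tendsto (fun J : ℕ => (J : ℝ) * ψ J) atTop (𝓝 0) ∧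
          ∀ (ν : ℕ → (j : ℕ) → Measure (GaugeField (F.P j) 0 (Matrix.specialUnitaryGroup (Fin 2) ℂ))),
            (∀ K, ν K K = T4GenFunBounds.gibbsMeasure (F.P K) ((F.scheme ℰp γ).β K)) →
            (∀ K j, j < K → ν K j = Measure.map (descend F ℰp j) (ν K (j + 1))) →
            ∀ (J K : ℕ) (hJK : J ≤ K) (ρ : GaugeField (F.P J) 0 (Matrix.specialUnitaryGroup (Fin 2) ℂ) → ℝ),
              (∀ U, PlaqSmall (θBal F.L γ (c * b₀) p₀ J) U → 0 < ρ U) →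
              ν K J = (fieldMeasure _ _ _).withDensity (fun U => ENNReal.ofReal (ρ U)) →
              ContinuousOn ρ {U | PlaqSmall (θBal F.L γ (c * b₀) p₀ J) U} →
              (∀ U : GaugeField (F.P J) 0 (Matrix.specialUnitaryGroup (Fin 2) ℂ), PlaqSmall (θBal F.L γ (c * b₀) p₀ J) U →
                  0 < heightDensityCan F γ hJK (histGood F ℰp (θBal F.L γ b₀ p₀) K J) U) →
              ∀ (b b' : PBond (F.P J) 0) (U V W Z : GaugeField (F.P J) 0 (Matrix.specialUnitaryGroup (Fin 2) ℂ)),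
                PlaqSmall (θBal F.L γ (c * b₀) p₀ J) U → PlaqSmall (θBal F.L γ (c * b₀) p₀ J) V →
                PlaqSmall (θBal F.L γ (c * b₀) p₀ J) W → PlaqSmall (θBal F.L γ (c * b₀) p₀ J) Z →
                (∀ e, e ≠ b → U e = V e) → (∀ e, e ≠ b' → U e = W e) → (∀ e, e ≠ b' → V e = Z e) → (∀ e, e ≠ b → W e = Z e) →
                |((fun U => Real.log (ρ U) - Real.log (heightDensityCan F γ hJK (histGood F ℰp (θBal F.L γ b₀ p₀) K J) U)) U -
                    (fun U => Real.log (ρ U) - Real.log (heightDensityCan F γ hJK (histGood F ℰp (θBal F.L γ b₀ p₀) K J) U)) V) -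
                  ((fun U => Real.log (ρ U) - Real.log (heightDensityCan F γ hJK (histGood F ℰp (θBal F.L γ b₀ p₀) K J) U)) W -
                    (fun U => Real.log (ρ U) - Real.log (heightDensityCan F γ hJK (histGood F ℰp (θBal F.L γ b₀ p₀) K J) U)) Z)|
                  ≤ ψ J * Real.exp (-(κ * (b.src.tdist b'.src : ℝ))) :=
  largeFieldFourPtIntCan_of_twoGasBarePackage fun L => by
    obtain ⟨μ, a₂, ha₂, c₀, hc₀, hc₀1, H⟩ := h2Wb L
    refine ⟨μ, a₂, ha₂, c₀, hc₀, hc₀1, fun c hc hcc₀ => ?_⟩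
    obtain ⟨pS, H⟩ := H c hc hcc₀
    refine ⟨pS, fun b₀ p₀ hb hpS hp => ?_⟩
    obtain ⟨γE, hγE, H⟩ := H b₀ p₀ hb hpS hp
    refine ⟨γE, hγE, fun F γ hFL hγ hγle J K hJK hR hP₁ hP₂ => ?_⟩
    obtain ⟨μ', hμ'μ, hμ'J, Λ, v, h₂, τ, κ', κh, hcat, hvloc, hvm, hKP, hhloc, hhm, hhbd, hκ', hτ, hκh, hweak⟩ :=
      H F γ hFL hγ hγle J K hJK hR hP₁ hP₂
    exact twoGasBareBody_of_fineWeakForm F c b₀ p₀ a₂ hJK μ μ' Λ v h₂ τ κ' κh hγ.le hμ'μ hμ'J hcat hvloc hvm hKP hhloc hhm hhbd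
      ⟨hκ', hτ, hκh⟩ hweak

end Summit.QuantumFields.YangMills.Theorems.FluctuationComparisonRegPrIntLLargeFieldGasBareOfWeakForm

end
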